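import Mathlib.RingTheory.Filtration
import Mathlib.RingTheory.Noetherian.Basic
import Mathlib.RingTheory.Finiteness.Cardinality
import HarnessLib

/-!
# Artin–Rees for Hom-modules: `I`-adic control of linear maps with small values, and lifting

Two consequences of the Artin–Rees lemma (Mathlib `Ideal.exists_pow_inf_eq_pow_smul`) for finite
modules `M`, `N` over a noetherian ring `B` and an ideal `I`, which are the affine-local input of the
full faithfulness half of Grothendieck's existence theorem (The Stacks Project, Tag 087W with
Tag 087V: `lim Γ(𝓗/Iⁿ𝓗) = Hom(G^∧, F^∧)` for `𝓗 = 𝓗om(G, F)`, proved there from the flatness of the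
completion; Görtz–Wedhorn II, Cor. 24.100). Both say that the two natural `I`-adic filtrations on
`Hom_B(M, N)` — by `Iⁿ Hom_B(M, N)` and by `Hom_B(M, IⁿN)` — are cofinal with a UNIFORM shift, and
that maps `M → N/IⁿN` lift to `M → N` up to a uniform loss (The Stacks Project, Tag 00IN
Artin–Rees, and Tag 07LU-style "map Artin–Rees"):

* `exists_shift_mem_pow_smul_of_apply_mem` — there is `c` with: a `B`-linear `ℓ : M → N` all of
  whose values lie in `I^{n+c}N` lies in `Iⁿ Hom_B(M, N)`;
* `exists_shift_lift` — for a finite presentation `f : Bʳ ↠ M` there is `c` with: every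
  `ŷ : Bʳ → N` sending `ker f` into `I^{n+c}N` (i.e. every "`M → N/I^{n+c}N`") is congruent modulo
  `IⁿN` on `Bʳ` to `ℓ ∘ f` for a genuine `ℓ : M → N`.

Everything is proved; no named facts.

## References

* The Stacks Project, Tag 00IN (Artin–Rees), Tag 087V, Tag 087W (Cohomology of Schemes,
  Lemmas 30.23.5, 30.24.1). [StacksProject]
* U. Görtz, T. Wedhorn, *Algebraic Geometry II* (2023), Cor. 24.100 (p. 569). [GortzWedhorn2023]
-/

universe u v w

namespace Literature.RingTheory.AdicTopology

open Submodule

variable {B : Type u} [CommRing B] (I : Ideal B)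
  {M : Type v} [AddCommGroup M] [Module B M] {N : Type w} [AddCommGroup N] [Module B N]

/-! ### Membership in `J • ⊤` for linear maps out of a finite free module -/

/-- A linear map `Bˢ → N` is the sum of its values on the standard basis times the coordinate
projections. [folklore] -/
theorem linearMap_pi_eq_sum {s : ℕ} (g : (Fin s → B) →ₗ[B] N) :
    g = ∑ j, (LinearMap.proj j : (Fin s → B) →ₗ[B] B).smulRight (g (Pi.single j 1)) := by
  ext j
  simp only [LinearMap.coe_comp, Function.comp_apply, LinearMap.coe_sum, Finset.sum_apply,
    LinearMap.smulRight_apply, LinearMap.coe_proj, Function.eval, LinearMap.coe_single]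
  rw [Finset.sum_eq_single j]
  · simp
  · intro k _ hkj
    rw [Pi.single_eq_of_ne hkj, zero_smul]
  · intro h
    exact absurd (Finset.mem_univ j) h

/-- **A linear map `Bˢ → N` with values on the standard basis in `J N` lies in `J Hom(Bˢ, N)`.**
[folklore] -/
theorem linearMap_mem_smul_top_of_apply_single (J : Ideal B) {s : ℕ} (g : (Fin s → B) →ₗ[B] N)
    (hg : ∀ j, g (Pi.single j 1) ∈ J • (⊤ : Submodule B N)) :
    g ∈ J • (⊤ : Submodule B ((Fin s → B) →ₗ[B] N)) := by
  rw [linearMap_pi_eq_sum g]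
  refine Submodule.sum_mem _ fun j _ => ?_
  -- `y ↦ projⱼ.smulRight y` is linear, so it maps `J N` into `J Hom`
  let L : N →ₗ[B] ((Fin s → B) →ₗ[B] N) :=
    { toFun := fun y => (LinearMap.proj j : (Fin s → B) →ₗ[B] B).smulRight y
      map_add' := fun y y' => by ext; simp
      map_smul' := fun b y => by ext; simp [smul_smul, mul_comm] }
  have h : (J • (⊤ : Submodule B N)).map L ≤ J • ⊤ := by
    rw [Submodule.map_smul'']
    exact smul_mono_right _ le_top
  exact h ⟨g (Pi.single j 1), hg j, rfl⟩

/-- Values of an element of `J Hom_B(P, N)` lie in `J N`. [folklore] -/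
theorem apply_mem_smul_top_of_mem {P : Type*} [AddCommGroup P] [Module B P] (J : Ideal B)
    {z : P →ₗ[B] N} (hz : z ∈ J • (⊤ : Submodule B (P →ₗ[B] N))) (p : P) :
    z p ∈ J • (⊤ : Submodule B N) := by
  have h : (J • (⊤ : Submodule B (P →ₗ[B] N))).map (LinearMap.applyₗ p) ≤ J • ⊤ := by
    rw [Submodule.map_smul'']
    exact smul_mono_right _ le_top
  exact h ⟨z, hz, rfl⟩

/-- A linear map out of a module with a surjection `f : Bʳ ↠ M`, all of whose values lie in `J N`,
composes with `f` to an element of `J Hom(Bʳ, N)`. [folklore] -/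
theorem comp_mem_smul_top_of_apply_mem (J : Ideal B) {r : ℕ} (f : (Fin r → B) →ₗ[B] M)
    (ℓ : M →ₗ[B] N) (hℓ : ∀ m, ℓ m ∈ J • (⊤ : Submodule B N)) :
    ℓ ∘ₗ f ∈ J • (⊤ : Submodule B ((Fin r → B) →ₗ[B] N)) :=
  linearMap_mem_smul_top_of_apply_single J _ fun _ => hℓ _

/-! ### Artin–Rees with a uniform shift for `Hom_B(M, N)` -/

section Noetherian

variable [IsNoetherianRing B] [Module.Finite B M] [Module.Finite B N]

/-- **Uniform Artin–Rees control of linear maps with small values**: there is `c` such that for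
all `n`, a `B`-linear `ℓ : M → N` with `ℓ(M) ⊆ I^{n+c} N` lies in `Iⁿ Hom_B(M, N)` (`B` noetherian,
`M`, `N` finite). Proof: embed `Hom_B(M, N) ↪ Hom_B(Bʳ, N) = Nʳ` by a surjection `Bʳ ↠ M` and apply
Artin–Rees to the image. [cite: StacksProject, Tag 00IN and Tag 087V] -/
theorem exists_shift_mem_pow_smul_of_apply_mem :
    ∃ c : ℕ, ∀ (n : ℕ) (ℓ : M →ₗ[B] N),
      (∀ m, ℓ m ∈ I ^ (n + c) • (⊤ : Submodule B N)) →
        ℓ ∈ I ^ n • (⊤ : Submodule B (M →ₗ[B] N)) := by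
  obtain ⟨r, f, hf⟩ := Module.Finite.exists_fin' B M
  -- `ι : Hom(M, N) ↪ Hom(Bʳ, N)`, precomposition with `f`
  let ι : (M →ₗ[B] N) →ₗ[B] ((Fin r → B) →ₗ[B] N) := LinearMap.lcomp B N f
  have hι : Function.Injective ι := fun ℓ ℓ' h =>
    LinearMap.ext fun m => by
      obtain ⟨ρ, rfl⟩ := hf m
      exact LinearMap.congr_fun h ρ
  obtain ⟨c, hc⟩ := Ideal.exists_pow_inf_eq_pow_smul I (LinearMap.range ι)
  refine ⟨c, fun n ℓ hℓ => ?_⟩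
  have h1 : ι ℓ ∈ I ^ (n + c) • ⊤ ⊓ LinearMap.range ι :=
    ⟨comp_mem_smul_top_of_apply_mem (I ^ (n + c)) f ℓ hℓ, ⟨ℓ, rfl⟩⟩
  rw [hc (n + c) (Nat.le_add_left c n), Nat.add_sub_cancel] at h1
  have h1' : ι ℓ ∈ I ^ n • LinearMap.range ι :=
    (Submodule.smul_mono (le_refl (I ^ n)) inf_le_right :
      I ^ n • (I ^ c • ⊤ ⊓ LinearMap.range ι) ≤ I ^ n • LinearMap.range ι) h1
  have h2 : ι ℓ ∈ (I ^ n • (⊤ : Submodule B (M →ₗ[B] N))).map ι := by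
    rwa [Submodule.map_smul'', Submodule.map_top]
  obtain ⟨ℓ', hℓ', he⟩ := h2
  exact hι he ▸ hℓ'

omit [Module.Finite B M] in
/-- **Uniform lifting of maps `M → N/IᵏN` up to a shift** (map Artin–Rees for a presentation): for a
surjection `f : Bʳ ↠ M` there is `c` such that for all `n`, every `B`-linear `ŷ : Bʳ → N` sending
`ker f` into `I^{n+c} N` agrees modulo `IⁿN` on `Bʳ` with `ℓ ∘ f` for some `B`-linear `ℓ : M → N`.
Proof: with generators `κ : Bˢ ↠ ker f`, Artin–Rees for the image of `ŷ ↦ ŷ ∘ κ` in `Hom(Bˢ, N)`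
gives `z ∈ Iⁿ Hom(Bʳ, N)` with `(ŷ - z) ∘ κ = 0`, and `ŷ - z` descends to `M`.
[cite: StacksProject, Tag 00IN and Tag 087V] -/
theorem exists_shift_lift {r : ℕ} (f : (Fin r → B) →ₗ[B] M) (hf : Function.Surjective f) :
    ∃ c : ℕ, ∀ (n : ℕ) (ŷ : (Fin r → B) →ₗ[B] N),
      (∀ ρ ∈ LinearMap.ker f, ŷ ρ ∈ I ^ (n + c) • (⊤ : Submodule B N)) →
        ∃ ℓ : M →ₗ[B] N, ∀ ρ, ℓ (f ρ) - ŷ ρ ∈ I ^ n • (⊤ : Submodule B N) := by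
  -- generators of the relation module
  obtain ⟨s, κ, hκ⟩ := (Submodule.fg_iff_exists_fin_linearMap B (Fin r → B)).mp
    (IsNoetherian.noetherian (LinearMap.ker f))
  -- `T : Hom(Bʳ, N) → Hom(Bˢ, N)`, precomposition with `κ`; its kernel is `Hom(M, N)`
  let T : ((Fin r → B) →ₗ[B] N) →ₗ[B] ((Fin s → B) →ₗ[B] N) := LinearMap.lcomp B N κ
  obtain ⟨c, hc⟩ := Ideal.exists_pow_inf_eq_pow_smul I (LinearMap.range T)
  refine ⟨c, fun n ŷ hŷ => ?_⟩
  -- `T ŷ ∈ I^{n+c} Hom(Bˢ, N) ∩ range T ⊆ Iⁿ range T`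
  have h1 : T ŷ ∈ I ^ (n + c) • ⊤ ⊓ LinearMap.range T := by
    refine ⟨linearMap_mem_smul_top_of_apply_single _ _ fun j => hŷ _ ?_, ⟨ŷ, rfl⟩⟩
    rw [← hκ]
    exact ⟨Pi.single j 1, rfl⟩
  rw [hc (n + c) (Nat.le_add_left c n), Nat.add_sub_cancel] at h1
  have h1' : T ŷ ∈ I ^ n • LinearMap.range T :=
    (Submodule.smul_mono (le_refl (I ^ n)) inf_le_right :
      I ^ n • (I ^ c • ⊤ ⊓ LinearMap.range T) ≤ I ^ n • LinearMap.range T) h1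
  have h2 : T ŷ ∈ (I ^ n • (⊤ : Submodule B ((Fin r → B) →ₗ[B] N))).map T := by
    rwa [Submodule.map_smul'', Submodule.map_top]
  obtain ⟨z, hz, hTz⟩ := h2
  -- `ŷ - z` kills `ker f = range κ`, hence descends to `M`
  have hkill : LinearMap.ker f ≤ LinearMap.ker (ŷ - z) := by
    rw [← hκ]
    rintro _ ⟨σ, rfl⟩
    rw [LinearMap.mem_ker, LinearMap.sub_apply, sub_eq_zero]
    exact (LinearMap.congr_fun hTz σ).symm
  let e := f.quotKerEquivOfSurjective hf
  refine ⟨(LinearMap.ker f).liftQ (ŷ - z) hkill ∘ₗ e.symm.toLinearMap, fun ρ => ?_⟩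
  have he : e.symm (f ρ) = Submodule.Quotient.mk ρ := by
    rw [LinearEquiv.symm_apply_eq]
    rfl
  rw [LinearMap.comp_apply, LinearEquiv.coe_toLinearMap, he, Submodule.liftQ_apply,
    LinearMap.sub_apply, sub_sub_cancel_left]
  exact Submodule.neg_mem _ (apply_mem_smul_top_of_mem (I ^ n) hz ρ)

end Noetherian

end Literature.RingTheory.AdicTopology
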